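import Summits.CriticalPhenomena.PercolationContinuityZ3.Theorems.PercNearOneGluingNoHeavyQuantTwoBlobLowCrossHeavyLong
import Summits.CriticalPhenomena.PercolationContinuityZ3.Theorems.PercNearOneGluingNoHeavyQuantTwoBlobTopFlippedLightLight
import Summits.CriticalPhenomena.PercolationContinuityZ3.Theorems.PercNearOneGluingNoHeavyQuantNoGiantClosure
import Summits.CriticalPhenomena.PercolationContinuityZ3.Theorems.PercNearOneGluingNoHeavyQuantConvGiantMode
import Summits.CriticalPhenomena.PercolationContinuityZ3.Theorems.PercNearOneGluingNoHeavyQuantAtomLightSlice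
import HarnessLib

/-!
# QUANT lane R8, T-DEC, binder (II) `LightSliceCore`: THE TWO PIECES OF THE LIGHT SLICE, case by case from LANDED lemmas —
# the light ⊗ expensive piece is DEC in the WHOLE core; the light ⊗ cheap piece is DEC off the low-cross / wide residue (census-2 g59)

builds on p205010 (kernel theorem, internal audit signed; external expert review pending)

Support file (`--supports stmt-CriticalPhenomena-4575`), QUANT lane seat prim-quant-census-2 (gen 59), rung R8 of
`run/shared/lean/prim/quant/LADDER.md`.  Memo `run/shared/lean/prim/quant/prim-quant-census-2-g59/ASSEMBLY-G59.md`.  Theorems only,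
standard axioms, no sorries, no definitions.

THE OBJECT.  After census-2 g58 (`…QuantConvAtomsAssembly`), statement (II) of the R8 law level is `LawDec.LightSliceCore`: the light slice
`lconv M₁ M₂ (TP[l₁′, h₁′; γ₁]) (atomLaw x T₂ j l₂ h₂ l₂′ h₂′)` of an ordered atom pair is DEC at `(T₁ + T₂, j)`, and by
`lightSlice_decAtT_of_pieces` it is the mixture of the two CELL PIECES
* piece E = `TP[l₁′, h₁′; γ₁] ∗ TP[l₂, h₂; g₂]` (light ⊗ EXPENSIVE: `γ₁ < x ≤ g₂`, the heavy cell is the LONGER one), and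
* piece C = `TP[l₁′, h₁′; γ₁] ∗ TP[l₂′, h₂′; γ₂]` (light ⊗ CHEAP: both gates `< x`, the second cell at least as long),
all gates being the minimal credit gates `gateOf` (so the target `T₁ + T₂` is EXACTLY the sum of the two ARCH credits).  This file proves,
for two credit-tight cells in the geometry of the core (cross cell `h₁′ + l₂ ≤ j`, `T₁ + T₂ ≤ 2(l₁′ + h₂)`), that
* **`LawDec.pieceE_decAtT`** — piece E is `DECAtT x (T₁+T₂) j (M₁+M₂)` in EVERY configuration, by the four-way split of the exact
  assembly census (census-2 g59 `code/assembly_census.py`; M ≤ 6, 7 floors: 193 607 core instances, piece E fails in 0):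
  (a) top cell not a giant (`h₁′ + h₂ ≤ j`): typer g23's no-giant closure `lconv_decAtT_noGiant`;
  (b) lower cross cell a giant (`j + 1 ≤ l₁′ + h₂`, crossed Type II only): the heavy cell is in GIANT MODE w.r.t. the light cell's bottom —
      lead g26's `lconv_decAtT_of_giantPool` (pool inequality `x(1 − g₂) ≤ (1 − x)g₂ ⟺ x ≤ g₂`);
  (c) top giant, cross mid, upper cross cell a conv-low (`2(h₁′ + l₂) < T₁ + T₂`): arm-2 g31's `lconv_lowCrossHeavyLongPairs_decAtT`
      (every aspect; the heavy cell is strictly longer);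
  (d) otherwise: arm-2 g31's top-flipped light–heavy piece `lconv_lightHeavyPairs_decAtT` (aspect `≤ 1 ≤ 4`).
* **`LawDec.pieceC_decAtT_noGiant`** / **`LawDec.pieceC_decAtT_topGiant`** — piece C is DEC when its top cell is not a giant
  (`lconv_decAtT_noGiant` with `LightLightTwoBlobDEC`), and when it is a giant provided the upper cross cell `h₁′ + l₂′` is NOT a conv-low and
  the cheap cell is at most 4 times as long as the light one (arm-2's `lconv_lightLightPairs_decAtT`).  What is left of piece C — top giant
  with a LOW CROSS CELL (`2(h₁′ + l₂′) < T₁ + T₂`; 558 / 1 934 such instances are NOT piece-wise at M ≤ 6) or a WIDE cheap cell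
  (`h₂′ − l₂′ > 4(h₁′ − l₁′)`; 0 / 204 piece-wise failures at M ≤ 6) — is the pooled residue typed in `…QuantLightSliceResidual`
  and assembled in `…QuantLightSliceAssembly`.
Auxiliary: `credit_light_eq_gateOf` / `credit_heavy_eq_gateOf` (at the minimal gate the ARCH credit is EXACTLY `T − 2l`),
`cell_decAtT_self` (a credit-tight cell is DEC at its own target at every layer at or above its head), `lconv_TP_TP_top`
(the convolution of two cells does not depend on the declared tops), `sum_TP_range_low` / `sum_TP_Ico_high`.

[this work]; DEC rules ARCH-TREES-G49 §2.2 / DEC-TAMP-G50 §3.1, the piece anatomy FOR-PROVERS-CONV-PIECES (lead g26), the covering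
lemmas of arm-2 g31 / typer g23 / lead g26 named above — this lane.  Nothing here is cited as a published result.  The gluing rows served
[cite: KozmaNitzan2024, Conjecture 3 (p. 15)]; product measure [cite: Grimmett1999, §1.3 p. 10].
-/

noncomputable section

namespace Summit.CriticalPhenomena.PercolationContinuityZ3.Theorems

namespace Quant

open Finset

/-- the two-point law `{lo, hi; g}` (as in `…QuantLawDEC`) -/
local notation3 "TP[" lo ", " hi ", " g ", " h "]" =>
  (g : ℝ) * (if (h : ℕ) = (hi : ℕ) then (1 : ℝ) else 0) + (1 - (g : ℝ)) * (if (h : ℕ) = (lo : ℕ) then (1 : ℝ) else 0)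

/-- the law `μ` shifted up by `s` (as in `…QuantConvHeavy`) -/
local notation3 "SH[" μ ", " s ", " h "]" => (if (s : ℕ) ≤ (h : ℕ) then (μ : ℕ → ℝ) ((h : ℕ) - (s : ℕ)) else (0 : ℝ))

namespace LawDec

/-! ### Credit-tight cells: exact credits, self-DEC, sums -/

section Cells

variable (x T : ℝ) (j l h : ℕ)

/-- **at a LIGHT minimal gate the light credit is exact**: `gateOf < x` ⟹ `(h − l)·(gateOf − x²)/(1 − x) = T − 2l`. [this work] -/
theorem credit_light_eq_gateOf (hx0 : 0 < x) (hx1 : x < 1) (hlow : 2 * (l : ℝ) < T) (hh : h ≤ j) (hc : T < (l : ℝ) + h)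
    (hlt : gateOf x T j l h < x) :
    ((h : ℝ) - l) * ((gateOf x T j l h - x ^ 2) / (1 - x)) = T - 2 * (l : ℝ) := by
  rw [gateOf_of_le x T j l h hh] at hlt ⊢
  have hd : (0 : ℝ) < (h : ℝ) - l := by linarith
  have h1x : (0 : ℝ) < 1 - x := by linarith
  set ρ : ℝ := (T - 2 * (l : ℝ)) / ((h : ℝ) - l) with hρ
  have hρx : ρ ≤ x := by
    by_contra hcon
    push Not at hcon
    have : ρ ≤ pairGate x T l h := le_max_left _ _
    linarith
  have e : pairGate x T l h = x ^ 2 + (1 - x) * ρ := pairGate_eq_light x T l h hx0.le hρx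
  rw [e]
  have : (x ^ 2 + (1 - x) * ρ - x ^ 2) / (1 - x) = ρ := by field_simp; ring
  rw [this, hρ]
  field_simp

/-- **at a HEAVY minimal gate the heavy credit is exact**: `x ≤ gateOf` (into a mid) ⟹ `(h − l)·gateOf = T − 2l`. [this work] -/
theorem credit_heavy_eq_gateOf (hx0 : 0 < x) (hx1 : x < 1) (hlow : 2 * (l : ℝ) < T) (hh : h ≤ j) (hc : T < (l : ℝ) + h)
    (hge : x ≤ gateOf x T j l h) :
    ((h : ℝ) - l) * gateOf x T j l h = T - 2 * (l : ℝ) := by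
  rw [gateOf_of_le x T j l h hh] at hge ⊢
  have hd : (0 : ℝ) < (h : ℝ) - l := by linarith
  set ρ : ℝ := (T - 2 * (l : ℝ)) / ((h : ℝ) - l) with hρ
  have hρx : x ≤ ρ := by
    by_contra hcon
    push Not at hcon
    have h2 : x ^ 2 + (1 - x) * ρ < x := by nlinarith
    have : pairGate x T l h < x := max_lt hcon h2
    linarith
  have e : pairGate x T l h = ρ := by
    refine max_eq_left ?_
    nlinarith [mul_le_mul_of_nonneg_left hρx hx0.le]
  rw [e, hρ]
  field_simp

/-- **a credit-tight cell is DEC at its own target at every layer `j′` at or above its head** (`h ≤ j′`), with any top `M ≥ h`: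
its single component `{l, h; gateOf}` is a valid (N)-pair. [this work] -/
theorem cell_decAtT_self (hx0 : 0 < x) (hx1 : x < 1) (hlow : 2 * (l : ℝ) < T) (hh : h ≤ j) (hc : T < (l : ℝ) + h)
    {j' M : ℕ} (hj' : h ≤ j') (hM : h ≤ M) :
    DECAtT x T j' M (fun t => TP[l, h, gateOf x T j l h, t]) := by
  have hlt : l < h := by
    by_contra hge; push Not at hge
    have : (h : ℝ) ≤ l := by exact_mod_cast hge
    linarith
  obtain ⟨hg0, hg1⟩ := gateOf_bounds x T j l h hx0 hx1 hlow hh hc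
  refine decAtT_single x T j' M l h _ ⟨by nlinarith, hg1.le⟩ hlt.le hM ?_
  refine validAt_creditPair x T ((T - 2 * (l : ℝ)) / ((h : ℝ) - l)) _ j' l h hlt hj' hx1 rfl ?_
  rw [gateOf_of_le x T j l h hh]
  rfl

/-- a two-point law is nonnegative for a gate in `[0, 1]`. -/
theorem TP_nonneg' (lo hi : ℕ) (g : ℝ) (hg0 : 0 ≤ g) (hg1 : g ≤ 1) (t : ℕ) : 0 ≤ TP[lo, hi, g, t] :=
  add_nonneg (mul_nonneg hg0 (by split_ifs <;> norm_num)) (mul_nonneg (by linarith) (by split_ifs <;> norm_num))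

/-- the mass of a cell below a level `J` between its two points is `1 − g`. [this work] -/
theorem sum_TP_range_low (lo hi J : ℕ) (g : ℝ) (hlo : lo ≤ J) (hhi : J < hi) :
    ∑ t ∈ Finset.range (J + 1), TP[lo, hi, g, t] = 1 - g := by
  rw [Finset.sum_add_distrib, ← Finset.mul_sum, ← Finset.mul_sum, Finset.sum_ite_eq' (Finset.range (J + 1)) hi,
    Finset.sum_ite_eq' (Finset.range (J + 1)) lo, if_neg (by simp; omega), if_pos (by simp; omega)]
  ring

/-- the mass of a cell above a level `J` between its two points is `g`. [this work] -/
theorem sum_TP_Ico_high (lo hi J M : ℕ) (g : ℝ) (hlo : lo ≤ J) (hhi : J < hi) (hM : hi ≤ M) :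
    ∑ t ∈ Finset.Ico (J + 1) (M + 1), TP[lo, hi, g, t] = g := by
  rw [Finset.sum_add_distrib, ← Finset.mul_sum, ← Finset.mul_sum, Finset.sum_ite_eq' (Finset.Ico (J + 1) (M + 1)) hi,
    Finset.sum_ite_eq' (Finset.Ico (J + 1) (M + 1)) lo, if_pos (by simp; omega), if_neg (by simp; omega)]
  ring

/-- **the convolution of two cells does not depend on the declared tops** (as long as they cover the cells). [this work] -/
theorem lconv_TP_TP_top (M₁ M₂ M₁' M₂' lo₁ hi₁ lo₂ hi₂ : ℕ) (γ g : ℝ) (h₁ : lo₁ ≤ hi₁) (hM₁ : hi₁ ≤ M₁) (hM₁' : hi₁ ≤ M₁')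
    (h₂ : lo₂ ≤ hi₂) (hM₂ : hi₂ ≤ M₂) (hM₂' : hi₂ ≤ M₂') :
    lconv M₁ M₂ (fun t => TP[lo₁, hi₁, γ, t]) (fun t => TP[lo₂, hi₂, g, t])
      = lconv M₁' M₂' (fun t => TP[lo₁, hi₁, γ, t]) (fun t => TP[lo₂, hi₂, g, t]) := by
  funext t
  rw [lconv_TP M₁ M₂ lo₂ hi₂ (fun s => TP[lo₁, hi₁, γ, s]) g (fun s hs => TP_eq_zero_of_top_lt lo₁ hi₁ M₁ γ h₁ hM₁ s hs)
      (h₂.trans hM₂) hM₂ t,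
    lconv_TP M₁' M₂' lo₂ hi₂ (fun s => TP[lo₁, hi₁, γ, s]) g (fun s hs => TP_eq_zero_of_top_lt lo₁ hi₁ M₁' γ h₁ hM₁' s hs)
      (h₂.trans hM₂') hM₂' t]

end Cells

/-! ### Two credit-tight cells whose top cell is not a giant -/

/-- **two credit-tight cells with `h₁ + h₂ ≤ j` convolve to a law DEC at `(T₁ + T₂, j)`** (any gates; typer g23's no-giant closure applied to
the two single-component data). [this work] -/
theorem cells_decAtT_noGiant (x T₁ T₂ : ℝ) (j M₁ M₂ l₁ h₁ l₂ h₂ : ℕ) (hx0 : 0 < x) (hx1 : x < 1)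
    (hlow₁ : 2 * (l₁ : ℝ) < T₁) (hh₁ : h₁ ≤ j) (hc₁ : T₁ < (l₁ : ℝ) + h₁) (hM₁ : h₁ ≤ M₁)
    (hlow₂ : 2 * (l₂ : ℝ) < T₂) (hh₂ : h₂ ≤ j) (hc₂ : T₂ < (l₂ : ℝ) + h₂) (hM₂ : h₂ ≤ M₂)
    (htop : h₁ + h₂ ≤ j) :
    DECAtT x (T₁ + T₂) j (M₁ + M₂)
      (lconv M₁ M₂ (fun t => TP[l₁, h₁, gateOf x T₁ j l₁ h₁, t]) (fun t => TP[l₂, h₂, gateOf x T₂ j l₂ h₂, t])) := by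
  have hlt₁ : l₁ < h₁ := by
    by_contra hge; push Not at hge
    have : (h₁ : ℝ) ≤ l₁ := by exact_mod_cast hge
    linarith
  have hlt₂ : l₂ < h₂ := by
    by_contra hge; push Not at hge
    have : (h₂ : ℝ) ≤ l₂ := by exact_mod_cast hge
    linarith
  have hd₁ := cell_decAtT_self x T₁ j l₁ h₁ hx0 hx1 hlow₁ hh₁ hc₁ (le_refl h₁) (le_refl h₁)
  have hd₂ := cell_decAtT_self x T₂ j l₂ h₂ hx0 hx1 hlow₂ hh₂ hc₂ (le_refl h₂) (le_refl h₂)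
  have key := lconv_decAtT_noGiant x T₁ T₂ h₁ h₂ j h₁ h₂ _ _ hx0 hx1
    (fun s hs => TP_eq_zero_of_top_lt l₁ h₁ h₁ _ hlt₁.le le_rfl s hs) le_rfl le_rfl htop hd₁ hd₂
  rw [lconv_TP_TP_top h₁ h₂ M₁ M₂ l₁ h₁ l₂ h₂ _ _ hlt₁.le le_rfl hM₁ hlt₂.le le_rfl hM₂] at key
  exact decAtT_mono_top key (by omega)

/-! ### Piece E: light ⊗ expensive -/

/-- **PIECE E OF THE LIGHT SLICE IS DEC IN THE WHOLE CORE.**  Two credit-tight cells at floor `0 < x < 1`: a LIGHT one `{l₁, h₁}` at target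
`T₁` (`usage < x/(1−x)`) and a HEAVY one `{l₂, h₂}` at target `T₂` (`x/(1−x) < usage`) which is STRICTLY LONGER (`h₁ − l₁ < h₂ − l₂`), heads
mids (`h_i ≤ j`), tops `M_i ≥ h_i`, `j < M₁ + M₂`, in the geometry of the core: the upper cross cell is a mid (`h₁ + l₂ ≤ j`) and the lower
cross cell is not a conv-low (`T₁ + T₂ ≤ 2(l₁ + h₂)`).  Then `TP[l₁,h₁;γ₁] ∗ TP[l₂,h₂;g₂]` (minimal gates) is `DECAtT x (T₁+T₂) j (M₁+M₂)`.
Four cases: no giant / lower cross cell a giant (giant pool) / low cross (arm-2's low-cross heavy-long piece) / top-flipped light–heavy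
piece (arm-2). [this work] -/
theorem pieceE_decAtT (x T₁ T₂ : ℝ) (j M₁ M₂ l₁ h₁ l₂ h₂ : ℕ) (hx0 : 0 < x) (hx1 : x < 1) (hj : j < M₁ + M₂)
    (hlow₁ : 2 * (l₁ : ℝ) < T₁) (hh₁ : h₁ ≤ j) (hc₁ : T₁ < (l₁ : ℝ) + h₁) (hM₁ : h₁ ≤ M₁)
    (hlight₁ : usage x T₁ j l₁ h₁ < x / (1 - x))
    (hlow₂ : 2 * (l₂ : ℝ) < T₂) (hh₂ : h₂ ≤ j) (hc₂ : T₂ < (l₂ : ℝ) + h₂) (hM₂ : h₂ ≤ M₂)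
    (hheavy₂ : x / (1 - x) < usage x T₂ j l₂ h₂)
    (hlong : h₁ - l₁ < h₂ - l₂) (hcross : h₁ + l₂ ≤ j) (hcB : T₁ + T₂ ≤ 2 * ((l₁ : ℝ) + h₂)) :
    DECAtT x (T₁ + T₂) j (M₁ + M₂)
      (lconv M₁ M₂ (fun t => TP[l₁, h₁, gateOf x T₁ j l₁ h₁, t]) (fun t => TP[l₂, h₂, gateOf x T₂ j l₂ h₂, t])) := by
  classical
  have hlt₁ : l₁ < h₁ := by
    by_contra hge; push Not at hge
    have : (h₁ : ℝ) ≤ l₁ := by exact_mod_cast hge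
    linarith
  have hlt₂ : l₂ < h₂ := by
    by_contra hge; push Not at hge
    have : (h₂ : ℝ) ≤ l₂ := by exact_mod_cast hge
    linarith
  set γ₁ := gateOf x T₁ j l₁ h₁ with hγ₁
  set g₂ := gateOf x T₂ j l₂ h₂ with hg₂
  obtain ⟨hγ0, hγ1⟩ := gateOf_bounds x T₁ j l₁ h₁ hx0 hx1 hlow₁ hh₁ hc₁
  obtain ⟨hg0, hg1⟩ := gateOf_bounds x T₂ j l₂ h₂ hx0 hx1 hlow₂ hh₂ hc₂
  have hγx : γ₁ < x := gate_lt_of_usage_lt x T₁ j l₁ h₁ hx1 hγ1 hlight₁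
  have hxg : x ≤ g₂ := (gate_gt_of_usage_gt x T₂ j l₂ h₂ hx1 hg1 hheavy₂).le
  have hcr₁ : ((h₁ : ℝ) - l₁) * ((γ₁ - x ^ 2) / (1 - x)) = T₁ - 2 * (l₁ : ℝ) :=
    credit_light_eq_gateOf x T₁ j l₁ h₁ hx0 hx1 hlow₁ hh₁ hc₁ hγx
  have hcr₂ : ((h₂ : ℝ) - l₂) * g₂ = T₂ - 2 * (l₂ : ℝ) := credit_heavy_eq_gateOf x T₂ j l₂ h₂ hx0 hx1 hlow₂ hh₂ hc₂ hxg
  by_cases htop : h₁ + h₂ ≤ j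
  · -- (a) no giant
    exact cells_decAtT_noGiant x T₁ T₂ j M₁ M₂ l₁ h₁ l₂ h₂ hx0 hx1 hlow₁ hh₁ hc₁ hM₁ hlow₂ hh₂ hc₂ hM₂ htop
  push Not at htop
  by_cases hgiant : j + 1 ≤ l₁ + h₂
  · -- (b) the lower cross cell is a giant: the heavy cell is in giant mode w.r.t. the light cell's bottom `l₁`
    have hl₁j : l₁ ≤ j := by omega
    have key := lconv_decAtT_of_giantPool x (T₁ + T₂) j (j - l₁) M₂ M₁
      (fun t => TP[l₂, h₂, g₂, t]) (fun t => TP[l₁, h₁, γ₁, t]) hx0 hx1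
      (TP_nonneg' l₂ h₂ g₂ (by linarith) hg1.le) (sum_TP_range M₂ l₂ h₂ g₂ (hlt₂.le.trans hM₂) hM₂)
      (TP_nonneg' l₁ h₁ γ₁ (by nlinarith) hγ1.le) (sum_TP_range M₁ l₁ h₁ γ₁ (hlt₁.le.trans hM₁) hM₁)
      (by omega) (by omega)
      (by
        intro b hb
        by_contra hlt
        push Not at hlt
        have hb1 : b ≠ h₁ := by omega
        have hb2 : b ≠ l₁ := by omega
        apply hb
        simp [hb1, hb2])
      (by
        rw [sum_TP_range_low l₂ h₂ (j - l₁) g₂ (by omega) (by omega),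
          sum_TP_Ico_high l₂ h₂ (j - l₁) M₂ g₂ (by omega) (by omega) hM₂]
        nlinarith)
    rw [lconv_comm, Nat.add_comm] at key
    exact key
  push Not at hgiant
  have hcross' : l₁ + h₂ ≤ j := by omega
  have hT' : T₁ + T₂ ≤ 2 * (l₁ : ℝ) + ((h₁ : ℝ) - l₁) * ((γ₁ - x ^ 2) / (1 - x)) + (2 * (l₂ : ℝ) + ((h₂ : ℝ) - l₂) * g₂) := by
    rw [hcr₁, hcr₂]; linarith
  have hcB' : ((h₁ : ℝ) - l₁) * ((γ₁ - x ^ 2) / (1 - x)) + ((h₂ : ℝ) - l₂) * g₂ ≤ 2 * ((h₂ : ℝ) - l₂) := by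
    rw [hcr₁, hcr₂]; linarith
  by_cases hlowx : 2 * ((h₁ : ℝ) + l₂) < T₁ + T₂
  · -- (c) low cross: arm-2's low-cross heavy-long piece
    exact lconv_lowCrossHeavyLongPairs_decAtT x (T₁ + T₂) γ₁ g₂ j M₁ M₂ l₁ h₁ l₂ h₂ hx0 hx1 hγ0 hγx hxg hg1.le hlt₁ hM₁ hlt₂ hM₂
      hlong hcross' (by omega) (by rw [hcr₁, hcr₂]; linarith) hcB' hT'
  · -- (d) top-flipped light–heavy piece
    push Not at hlowx
    exact lconv_lightHeavyPairs_decAtT x (T₁ + T₂) γ₁ g₂ j M₁ M₂ l₁ h₁ l₂ h₂ hx0 hx1 hγ0 hγx hxg hg1.le hlt₁ hM₁ hlt₂ hM₂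
      (by omega) hcross hcross' (by omega) (by rw [hcr₁, hcr₂]; linarith) hcB' hT'

/-! ### Piece C: light ⊗ cheap -/

/-- **PIECE C, TOP NOT A GIANT** (`h₁ + h₂ ≤ j`): two light credit-tight cells convolve to a DEC law (any aspect, any cross pattern). [this work] -/
theorem pieceC_decAtT_noGiant (x T₁ T₂ : ℝ) (j M₁ M₂ l₁ h₁ l₂ h₂ : ℕ) (hx0 : 0 < x) (hx1 : x < 1)
    (hlow₁ : 2 * (l₁ : ℝ) < T₁) (hh₁ : h₁ ≤ j) (hc₁ : T₁ < (l₁ : ℝ) + h₁) (hM₁ : h₁ ≤ M₁)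
    (hlow₂ : 2 * (l₂ : ℝ) < T₂) (hh₂ : h₂ ≤ j) (hc₂ : T₂ < (l₂ : ℝ) + h₂) (hM₂ : h₂ ≤ M₂)
    (htop : h₁ + h₂ ≤ j) :
    DECAtT x (T₁ + T₂) j (M₁ + M₂)
      (lconv M₁ M₂ (fun t => TP[l₁, h₁, gateOf x T₁ j l₁ h₁, t]) (fun t => TP[l₂, h₂, gateOf x T₂ j l₂ h₂, t])) :=
  cells_decAtT_noGiant x T₁ T₂ j M₁ M₂ l₁ h₁ l₂ h₂ hx0 hx1 hlow₁ hh₁ hc₁ hM₁ hlow₂ hh₂ hc₂ hM₂ htop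

/-- **PIECE C, TOP A GIANT, OFF THE RESIDUE**: two LIGHT credit-tight cells `{l₁, h₁}` (target `T₁`) and `{l₂, h₂}` (target `T₂`), the second
at least as long and AT MOST 4 TIMES as long (`h₁ − l₁ ≤ h₂ − l₂ ≤ 4(h₁ − l₁)`), top cell a giant (`j + 1 ≤ h₁ + h₂`), lower cross cell a mid
(`l₁ + h₂ ≤ j`), NEITHER cross cell a conv-low (`T₁ + T₂ ≤ 2(h₁ + l₂)`, `T₁ + T₂ ≤ 2(l₁ + h₂)`): the piece is DEC — arm-2 g31's top-flipped
light–light piece. [this work] -/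
theorem pieceC_decAtT_topGiant (x T₁ T₂ : ℝ) (j M₁ M₂ l₁ h₁ l₂ h₂ : ℕ) (hx0 : 0 < x) (hx1 : x < 1)
    (hlow₁ : 2 * (l₁ : ℝ) < T₁) (hh₁ : h₁ ≤ j) (hc₁ : T₁ < (l₁ : ℝ) + h₁) (hM₁ : h₁ ≤ M₁)
    (hlight₁ : usage x T₁ j l₁ h₁ < x / (1 - x))
    (hlow₂ : 2 * (l₂ : ℝ) < T₂) (hh₂ : h₂ ≤ j) (hc₂ : T₂ < (l₂ : ℝ) + h₂) (hM₂ : h₂ ≤ M₂)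
    (hlight₂ : usage x T₂ j l₂ h₂ < x / (1 - x))
    (hasp : h₁ - l₁ ≤ h₂ - l₂) (hasp' : h₂ - l₂ ≤ 4 * (h₁ - l₁)) (htop : j + 1 ≤ h₁ + h₂) (hcross : l₁ + h₂ ≤ j)
    (hcA : T₁ + T₂ ≤ 2 * ((h₁ : ℝ) + l₂)) (hcB : T₁ + T₂ ≤ 2 * ((l₁ : ℝ) + h₂)) :
    DECAtT x (T₁ + T₂) j (M₁ + M₂)
      (lconv M₁ M₂ (fun t => TP[l₁, h₁, gateOf x T₁ j l₁ h₁, t]) (fun t => TP[l₂, h₂, gateOf x T₂ j l₂ h₂, t])) := by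
  classical
  have hlt₁ : l₁ < h₁ := by
    by_contra hge; push Not at hge
    have : (h₁ : ℝ) ≤ l₁ := by exact_mod_cast hge
    linarith
  have hlt₂ : l₂ < h₂ := by
    by_contra hge; push Not at hge
    have : (h₂ : ℝ) ≤ l₂ := by exact_mod_cast hge
    linarith
  set γ₁ := gateOf x T₁ j l₁ h₁ with hγ₁
  set γ₂ := gateOf x T₂ j l₂ h₂ with hγ₂
  obtain ⟨hγ0, hγ1⟩ := gateOf_bounds x T₁ j l₁ h₁ hx0 hx1 hlow₁ hh₁ hc₁
  obtain ⟨hg0, hg1⟩ := gateOf_bounds x T₂ j l₂ h₂ hx0 hx1 hlow₂ hh₂ hc₂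
  have hγx : γ₁ < x := gate_lt_of_usage_lt x T₁ j l₁ h₁ hx1 hγ1 hlight₁
  have hgx : γ₂ < x := gate_lt_of_usage_lt x T₂ j l₂ h₂ hx1 hg1 hlight₂
  have hcr₁ : ((h₁ : ℝ) - l₁) * ((γ₁ - x ^ 2) / (1 - x)) = T₁ - 2 * (l₁ : ℝ) :=
    credit_light_eq_gateOf x T₁ j l₁ h₁ hx0 hx1 hlow₁ hh₁ hc₁ hγx
  have hcr₂ : ((h₂ : ℝ) - l₂) * ((γ₂ - x ^ 2) / (1 - x)) = T₂ - 2 * (l₂ : ℝ) :=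
    credit_light_eq_gateOf x T₂ j l₂ h₂ hx0 hx1 hlow₂ hh₂ hc₂ hgx
  have hcross₁ : h₁ + l₂ ≤ j := by omega
  exact lconv_lightLightPairs_decAtT x (T₁ + T₂) γ₁ γ₂ j M₁ M₂ l₁ h₁ l₂ h₂ hx0 hx1 hγ0 hγx hg0 hgx hlt₁ hM₁ hlt₂ hM₂
    (by omega) hasp' hcross₁ hcross htop (by rw [hcr₁, hcr₂]; linarith) (by rw [hcr₁, hcr₂]; linarith)
    (by rw [hcr₁, hcr₂]; linarith)

end LawDec

end Quant

end Summit.CriticalPhenomena.PercolationContinuityZ3.Theorems
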